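import Summits.CriticalPhenomena.CardyFormulaZ2.Theorems.CardySelfRefinementLagHandOffNoSlidingArms
import Summits.CriticalPhenomena.CardyFormulaZ2.Theorems.CardySelfRefinementLagHandOffNoSlidingCurves
import Summits.CriticalPhenomena.CardyFormulaZ2.Theorems.CardySelfRefinementLagHandOffNoIdle
import HarnessLib

/-!
# No sliding of the limit interface (assembly): registered stub `stub_quadTransfer_noSliding`

Line `hitting-tournament` of crux `LagHandOff` (stmt-CriticalPhenomena-10268), namespace
`Summit.CriticalPhenomena.CardyFormulaZ2.Cruxes.LagHandOff.HittingTournament`.  Along positive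
meshes `δₙ → 0`, every weak limit `ν` of the interface laws of a `ℤ²`-discretisation family of
a Dobrushin domain `(D; a, b)` is carried by curve classes none of whose representatives `c` has
a non-trivial parameter stretch `[s, t]` on which `Re(ū c)` is constant, for every unit vector
`u`: the limit curve never slides along a straight line.

Assembly of the landed helpers:

* `ν`-a.s. the class is chordal and traces no boundary arc
  (`stub_limitCurveRegularity_chordal_noTrace`), so a violating stretch passes through every
  point of a bulk segment `{u(p₀ + iy) : y ∈ [a, a + ℓ]}` with its `3ℓ`-neighbourhood in `D`
  (`exists_segment_of_straightStretch`, part 2); shrinking, `ℓ = 1/(m+1)`;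
* for each `m` and each `k`, with `ρ = ℓ/(40(k+1))`, the class then lies in the OPEN net event
  `G m k` = "for some chain `z_j = u(k₁ρ/2 + i(k₂ρ/2 + 40ρj))`, `j ≤ k + 1`, of the net
  (`|k₁|, |k₂| ≤ ⌈2 Rad/ρ⌉ + 1`) all of whose points are at distance `≥ 44ρ` from `∂D`, the
  trace comes within `ρ` of every `z_j`" (`exists_net_of_segment`,
  `isOpen_setOf_exists_forall_infDist_lt`, part 2);
* along the family, `P(interface class ∈ G m k) ≤ |net| (4^{-α})^{k+1}` for all small meshes
  (`eventually_measure_preimage_visits_le`, part 1: `k + 1` independent open arms in disjoint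
  annuli, RSW `annulusOpenCrossing_half_le_holds`), and `|net| = O((k+1)²)`, so the bound tends
  to `0` (`tendsto_ofReal_mul_pow_succ`); by the portmanteau inequality for open sets
  (`measure_iInter_eq_zero_of_eventually_le`) `ν (⋂ₖ G m k) = 0` for every `m`.

References: M. Aizenman, A. Burchard, Duke Math. J. 99 (1999), §2 and App. A; G. Grimmett,
*Percolation* (1999), §11.7–11.8; P. Billingsley, *Convergence of probability measures*
(1999), Thm. 2.1.
-/

noncomputable section

open MeasureTheory Filter Set Topology Metric
open scoped unitInterval BoundedContinuousFunction ENNReal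
open Literature.Probability.Percolation Literature.Probability.LatticeModels
open Literature.Probability.RandomPlanarGeometry

namespace Summit.CriticalPhenomena.CardyFormulaZ2.Cruxes.LagHandOff.HittingTournament

/-! ### Bookkeeping: separation of the chains, size of the net, decay of the bound -/

/-- Distinct points of a chain `u(p + i(q + 40ρj))` are at distance `≥ 40ρ`. -/
theorem dist_chain_ge {u : ℂ} (hu : ‖u‖ = 1) {ρ : ℝ} (hρ : 0 ≤ ρ) (p q : ℝ) {j j' : ℕ}
    (hjj' : j ≠ j') :
    40 * ρ ≤ dist (u * ((p : ℂ) + ((q + 40 * ρ * j : ℝ) : ℂ) * Complex.I))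
      (u * ((p : ℂ) + ((q + 40 * ρ * j' : ℝ) : ℂ) * Complex.I)) := by
  rw [dist_frame_same hu]
  have e : q + 40 * ρ * j - (q + 40 * ρ * j') = 40 * ρ * ((j : ℝ) - j') := by ring
  rw [e, abs_mul, abs_of_nonneg (by positivity : (0 : ℝ) ≤ 40 * ρ)]
  have h1 : (1 : ℝ) ≤ |(j : ℝ) - j'| := by
    rcases lt_or_gt_of_ne hjj' with h | h
    · have : (j : ℝ) + 1 ≤ j' := by exact_mod_cast h
      rw [abs_of_neg (by linarith)]
      linarith
    · have : (j' : ℝ) + 1 ≤ j := by exact_mod_cast h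
      rw [abs_of_pos (by linarith)]
      linarith
  nlinarith

/-- The net `[-M, M]² ∩ ℤ²` has `(2M + 1)²` points. -/
theorem card_Icc_prod_Icc (M : ℕ) :
    ((Finset.Icc (-(M : ℤ)) M) ×ˢ (Finset.Icc (-(M : ℤ)) M)).card = (2 * M + 1) ^ 2 := by
  rw [Finset.card_product, Int.card_Icc]
  have : ((M : ℤ) + 1 - -(M : ℤ)).toNat = 2 * M + 1 := by omega
  rw [this, sq]

/-- **Exponential beats quadratic**: if `0 ≤ a k ≤ B (k+1)²` and `0 ≤ θ < 1`, then
`a k θ^{k+1} → 0` (in `ℝ≥0∞`). -/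
theorem tendsto_ofReal_mul_pow_succ {θ B : ℝ} (hθ0 : 0 ≤ θ) (hθ1 : θ < 1) {a : ℕ → ℝ}
    (ha0 : ∀ k, 0 ≤ a k) (ha : ∀ k, a k ≤ B * ((k : ℝ) + 1) ^ 2) :
    Tendsto (fun k => ENNReal.ofReal (a k * θ ^ (k + 1))) atTop (𝓝 0) := by
  have hlim : Tendsto (fun k : ℕ => B * (((k + 1 : ℕ) : ℝ) ^ 2 * θ ^ (k + 1))) atTop (𝓝 0) := by
    have h1 := tendsto_pow_const_mul_const_pow_of_abs_lt_one 2
      (show |θ| < 1 by rwa [abs_of_nonneg hθ0])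
    have h2 := (h1.comp (tendsto_add_atTop_nat 1)).const_mul B
    rw [mul_zero] at h2
    exact h2
  rw [← ENNReal.ofReal_zero]
  refine ENNReal.tendsto_ofReal ?_
  refine tendsto_of_tendsto_of_tendsto_of_le_of_le tendsto_const_nhds hlim (fun k => ?_)
    fun k => ?_
  · exact mul_nonneg (ha0 k) (pow_nonneg hθ0 _)
  · have := ha k
    push_cast
    calc a k * θ ^ (k + 1) ≤ B * ((k : ℝ) + 1) ^ 2 * θ ^ (k + 1) :=
          mul_le_mul_of_nonneg_right this (pow_nonneg hθ0 _)
      _ = B * (((k : ℝ) + 1) ^ 2 * θ ^ (k + 1)) := by ring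

/-! ### The registered stub: a.s. no sliding of the limit interface -/

/-- **Registered stub `stub_quadTransfer_noSliding`** (line `hitting-tournament`): along
positive meshes `δₙ → 0`, every weak limit `ν` of the interface laws of a `ℤ²`-discretisation
family of `(D; a, b)` is carried by curve classes none of whose representatives has a
non-trivial parameter stretch on which `Re(ū c)` is constant (`‖u‖ = 1`).  See the module
docstring for the assembly. [cite: AizenmanBurchardDuke1999, Appendix A] -/
theorem stub_quadTransfer_noSliding : ∀ (D : DobrushinDomain) (E : ℝ → DiscreteDobrushin), ZdDiscretisationFamily D E → ∀ δs : ℕ → ℝ, (∀ n, 0 < δs n) → Tendsto δs atTop (𝓝 0) → ∀ (ν : Measure (CurveClass ℂ)) [IsProbabilityMeasure ν], (∀ f : CurveClass ℂ →ᵇ ℝ, Tendsto (fun n => ∫ ω, f (bondInterfaceIn D (E (δs n)) ω) ∂(bondPercolation (zdGraph 2) half)) atTop (𝓝 (∫ γ, f γ ∂ν))) → ∀ u : ℂ, ‖u‖ = 1 → ∀ᵐ γ ∂ν, ∀ c : Curve ℂ, CurveClass.mk c = γ → ∀ s t : I, s < t → (∀ r ∈ Set.Icc s t, (starRingEnd ℂ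 u * c r).re = (starRingEnd ℂ u * c s).re) → ∀ r ∈ Set.Icc s t, c r = c s := by
  intro D E hE δs hpos hlim ν hν hconv u hu
  classical
  have hδs : Tendsto δs atTop (𝓝[>] 0) :=
    tendsto_nhdsWithin_iff.2 ⟨hlim, Eventually.of_forall hpos⟩
  have hXm : ∀ n, Measurable (bondInterfaceIn D (E (δs n))) := fun n =>
    Theorems.LagHandOff.Negative.measurable_bondInterfaceIn_family hE (hpos n)
  obtain ⟨α, c₀, hα, -, hRSW⟩ := annulusOpenCrossing_half_le_holds
  obtain ⟨Rad, hRadsub⟩ := D.isBounded.closure.subset_closedBall (0 : ℂ)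
  set Rad₀ : ℝ := max Rad 0 with hRad₀
  have hRad₀nn : 0 ≤ Rad₀ := le_max_right _ _
  have hRad₀sub : closure D.carrier ⊆ closedBall (0 : ℂ) Rad₀ :=
    hRadsub.trans (closedBall_subset_closedBall (le_max_left _ _))
  have hfrne : (frontier D.carrier).Nonempty := ⟨_, D.pt_mem_frontier 0⟩
  ---------------------------------------------------------------- the decay rate
  set θ : ℝ := (1 / 4 : ℝ) ^ α with hθ
  have hθ0 : 0 ≤ θ := Real.rpow_nonneg (by norm_num) _
  have hθ1 : θ < 1 := Real.rpow_lt_one (by norm_num) (by norm_num) hα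
  ---------------------------------------------------------------- scales, net, events
  set ℓ : ℕ → ℝ := fun m => 1 / ((m : ℝ) + 1) with hℓ
  have hℓpos : ∀ m, 0 < ℓ m := fun m => by simp only [hℓ]; positivity
  set ρ : ℕ → ℕ → ℝ := fun m k => ℓ m / (40 * ((k : ℝ) + 1)) with hρ
  have hρpos : ∀ m k, 0 < ρ m k := fun m k => by
    simp only [hρ]
    exact div_pos (hℓpos m) (by positivity)
  set M : ℕ → ℕ → ℕ := fun m k => ⌈2 * Rad₀ / ρ m k⌉₊ + 1 with hM
  set grid : ℕ → ℕ → Finset (ℤ × ℤ) := fun m k =>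
    (Finset.Icc (-(M m k : ℤ)) (M m k)) ×ˢ (Finset.Icc (-(M m k : ℤ)) (M m k)) with hgrid
  set Z : ℝ → ℤ × ℤ → ℕ → ℂ := fun r kk j =>
    u * ((((kk.1 : ℝ) * r / 2 : ℝ) : ℂ) + (((kk.2 : ℝ) * r / 2 + 40 * r * j : ℝ) : ℂ) * Complex.I)
    with hZ
  set G : ℕ → ℕ → Set (CurveClass ℂ) := fun m k => {γ | ∃ kk ∈ grid m k,
    (∀ j ≤ k + 1, 44 * ρ m k ≤ infDist (Z (ρ m k) kk j) (frontier D.carrier)) ∧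
      ∀ j ≤ k + 1, infDist (Z (ρ m k) kk j) γ.range < ρ m k} with hG
  have hGopen : ∀ m k, IsOpen (G m k) := fun m k =>
    isOpen_setOf_exists_forall_infDist_lt (grid m k) _ (Z (ρ m k)) (k + 1) (ρ m k)
  have hsep : ∀ (m k : ℕ) (kk : ℤ × ℤ) (j j' : ℕ), j ≠ j' →
      40 * ρ m k ≤ dist (Z (ρ m k) kk j) (Z (ρ m k) kk j') := fun m k kk j j' hjj' =>
    dist_chain_ge hu (hρpos m k).le _ _ hjj'
  ---------------------------------------------------------------- size of the net
  have hcard : ∀ m k : ℕ, ((grid m k).card : ℝ) ≤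
      (160 * Rad₀ * ((m : ℝ) + 1) + 5) ^ 2 * ((k : ℝ) + 1) ^ 2 := by
    intro m k
    have hk1 : (1 : ℝ) ≤ (k : ℝ) + 1 := by linarith [(k.cast_nonneg : (0 : ℝ) ≤ k)]
    have hm0 : (0 : ℝ) ≤ 160 * Rad₀ * ((m : ℝ) + 1) := by positivity
    have e : 2 * Rad₀ / ρ m k = 80 * Rad₀ * ((m : ℝ) + 1) * ((k : ℝ) + 1) := by
      simp only [hρ, hℓ]
      field_simp
      ring
    have hMle : (M m k : ℝ) ≤ 80 * Rad₀ * ((m : ℝ) + 1) * ((k : ℝ) + 1) + 2 := by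
      have h := Nat.ceil_lt_add_one (div_nonneg (by positivity) (hρpos m k).le :
        (0 : ℝ) ≤ 2 * Rad₀ / ρ m k)
      have h2 : (⌈2 * Rad₀ / ρ m k⌉₊ : ℝ) < 80 * Rad₀ * ((m : ℝ) + 1) * ((k : ℝ) + 1) + 1 := by
        linarith
      simp only [hM]
      push_cast
      linarith
    have hgridcard : ((grid m k).card : ℝ) = (2 * (M m k : ℝ) + 1) ^ 2 := by
      simp only [hgrid]
      rw [card_Icc_prod_Icc]
      push_cast
      ring
    rw [hgridcard, ← mul_pow]
    refine pow_le_pow_left₀ (by positivity) ?_ 2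
    nlinarith
  ---------------------------------------------------------------- the null events
  have hnull : ∀ m, ν (⋂ k, G m k) = 0 := by
    intro m
    refine measure_iInter_eq_zero_of_eventually_le (X := fun n => bondInterfaceIn D (E (δs n)))
      (P := bondPercolation (zdGraph 2) half) hXm hconv (hGopen m)
      (b := fun k => ENNReal.ofReal (((grid m k).card : ℝ) * θ ^ (k + 1))) ?_ ?_
    · intro k
      have hev := hδs.eventually (eventually_measure_preimage_visits_le D hE hα hRSW (hρpos m k)
        (grid m k) (fun kk _ j j' hjj' => hsep m k kk j j' hjj') (k + 1))
      filter_upwards [hev] with n hn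
      exact hn
    · exact tendsto_ofReal_mul_pow_succ hθ0 hθ1 (fun k => Nat.cast_nonneg _) (hcard m)
  have hae : ∀ᵐ γ ∂ν, ∀ m, ∃ k, γ ∉ G m k := by
    rw [ae_all_iff]
    intro m
    have h := (measure_eq_zero_iff_ae_notMem (μ := ν)).1 (hnull m)
    filter_upwards [h] with γ hγ
    simpa only [mem_iInter, not_forall] using hγ
  ---------------------------------------------------------------- conclusion
  filter_upwards [stub_limitCurveRegularity_chordal_noTrace D E hE δs hpos hlim ν hconv, hae]
    with γ hreg hGγ c hc s t hst hconst
  obtain ⟨⟨-, -, hrange⟩, hnt⟩ := hreg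
  by_contra hnot
  push Not at hnot
  obtain ⟨r₀, hr₀, hne⟩ := hnot
  have hγr : γ.range = Set.range c := by
    rw [← hc, CurveClass.range_mk]
    rfl
  have hcl : ∀ r, c r ∈ closure D.carrier := fun r => hrange (by rw [hγr]; exact ⟨r, rfl⟩)
  obtain ⟨p₀, a, ℓ₀, hℓ₀, hseg⟩ :=
    exists_segment_of_straightStretch D hu hcl (hnt c hc) hst hconst hr₀ hne
  obtain ⟨m, hm⟩ := exists_nat_one_div_lt hℓ₀
  have hℓm : ℓ m < ℓ₀ := hm
  have hseg' : ∀ y ∈ Icc a (a + ℓ m), u * ((p₀ : ℂ) + (y : ℂ) * Complex.I) ∈ γ.range ∧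
      ball (u * ((p₀ : ℂ) + (y : ℂ) * Complex.I)) (3 * ℓ m) ⊆ D.carrier := by
    intro y hy
    have hy' : y ∈ Icc a (a + ℓ₀) := ⟨hy.1, hy.2.trans (by linarith)⟩
    obtain ⟨⟨r, hr⟩, hball⟩ := hseg y hy'
    refine ⟨?_, (ball_subset_ball (by linarith)).trans hball⟩
    rw [hγr]
    exact ⟨r, hr⟩
  have hRad' : γ.range ⊆ closedBall 0 Rad₀ := hrange.trans hRad₀sub
  obtain ⟨k, hk⟩ := hGγ m
  have hρk : ρ m k = ℓ m / (40 * ((k + 1 : ℕ) : ℝ)) := by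
    simp only [hρ]
    push_cast
    ring
  obtain ⟨kk, hkk, hgood, hnear⟩ := exists_net_of_segment hu D.isOpen hfrne hRad' (hℓpos m)
    hseg' (Nat.succ_pos k) hρk
  exact hk ⟨kk, hkk, hgood, hnear⟩

end Summit.CriticalPhenomena.CardyFormulaZ2.Cruxes.LagHandOff.HittingTournament

end
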